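import Summits.Parity.GeneralizedHardyLittlewood.Theorems.PrimeLevelFamEdgeIdeaDeltasFloorDualPoisson
import HarnessLib

/-!
# Route `PrimeLevelFamEdge` — TYPED IDEA DELTAS, deck 18g: K-L21-3 — CELL BOOKKEEPING for `QuarterParseval`, part 1
# (periodicity of the AH¼ form factor `fullDensity`, measurability, the lattice sum in real form `quarter_poisson_real`,
# the decomposition `ℝ = ⊔_j (4j−2, 4j+2]` (`integral_eq_tsum_cells`) and the dominated interchange
# `integral_fullDensity_mul`).  Seat ls-idea-lens-21 g2, `Sketch_L21_DualWitness.lean` v1.6 sha16 18bf34caa2eaa694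
# l.1168–1490 VERBATIM (ns `.FloorDual`, QD names of decks 18c–18f; critic F b26.8: v1.6 VERIFIED — `--axioms heightWallLowerEdge`
# standard, no sorryAx, 40 new / 0 changed decls); typer ls-idea-typ-1 gen 3.  Part 2 + the assembly = deck 18h.
HONESTY: Fourier/measure bookkeeping for an explicit lattice–periodic pair; a no-go theorem about the cell's own
one-sided certificate class, nothing about zeta zeros; no exceptional-zero theorem (no Landau–Siegel / Siegel-zero exclusion,
no Theorem 1–2 of arXiv:2211.02515, no repaired Margin232) is proved; typed ≠ proved for the Laplace / realisability shapes.
-/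

namespace Summit.Parity.GeneralizedHardyLittlewood.Theorems.PrimeLevelFamEdgeIdeaDeltas.FloorDual

open Literature.NumberTheory.LFunctions MeasureTheory
open scoped Real

section Bookkeeping
open Complex (I)

/-! #### Periodicity, the full density, measurability -/

/-- `nearestFour` is `4ℤ`-equivariant. -/
theorem nearestFour_add_four_mul (α : ℝ) (j : ℤ) :
    nearestFour (α + 4 * j) = nearestFour α + 4 * j := by
  unfold nearestFour
  rw [show (α + 4 * (j : ℝ) + 2) / 4 = (α + 2) / 4 + j by ring, Int.floor_add_intCast]
  push_cast
  ring

/-- On `[−2,2)` the nearest point of `4ℤ` is `0`. -/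
theorem nearestFour_of_mem {α : ℝ} (h1 : -2 ≤ α) (h2 : α < 2) : nearestFour α = 0 := by
  unfold nearestFour
  have : ⌊(α + 2) / 4⌋ = 0 := by
    rw [Int.floor_eq_iff]; constructor <;> push_cast <;> linarith
  rw [this]; simp

/-- `nearestFour 2 = 4`. -/
theorem nearestFour_two : nearestFour 2 = 4 := by
  unfold nearestFour; norm_num

/-- The full 4-periodic density `G = |α − 4j|` on `|α − 4j| ≤ 1`, `t` elsewhere. -/
noncomputable def fullDensity (α : ℝ) : ℝ :=
  if |α - nearestFour α| ≤ 1 then |α - nearestFour α| else quarterLevel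

/-- The full density is `4`-periodic. -/
theorem fullDensity_add_four_mul (α : ℝ) (j : ℤ) : fullDensity (α + 4 * j) = fullDensity α := by
  unfold fullDensity
  rw [nearestFour_add_four_mul, show α + 4 * (j : ℝ) - (nearestFour α + 4 * j) = α - nearestFour α by ring]

/-- On the cell `[−2,2]`: `G = |β|` if `|β| ≤ 1`, else `t`. -/
theorem fullDensity_cell {β : ℝ} (h : |β| ≤ 2) :
    fullDensity β = if |β| ≤ 1 then |β| else quarterLevel := by
  have hb := abs_le.mp h
  rcases lt_or_eq_of_le hb.2 with h2 | h2
  · unfold fullDensity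
    rw [nearestFour_of_mem hb.1 h2, sub_zero]
  · subst h2
    unfold fullDensity
    rw [nearestFour_two]
    norm_num

/-- Full density = beyond-band density + the core `|α|` on `[−1,1]`. -/
theorem fullDensity_eq_quarterDensity_add (α : ℝ) :
    fullDensity α = quarterDensity α + Set.indicator (Set.Icc (-1 : ℝ) 1) (fun x => |x|) α := by
  by_cases h : |α| ≤ 1
  · have hα := abs_le.mp h
    rw [quarterDensity_of_abs_le h, Set.indicator_of_mem (show α ∈ Set.Icc (-1:ℝ) 1 from ⟨hα.1, hα.2⟩),
      fullDensity_cell (by linarith [abs_nonneg α] : |α| ≤ 2), if_pos h, zero_add]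
  · rw [Set.indicator_of_notMem (fun hm => h (abs_le.mpr ⟨hm.1, hm.2⟩)), add_zero]
    unfold fullDensity quarterDensity
    rw [if_neg h]

/-- The full density is non-negative. -/
theorem fullDensity_nonneg (α : ℝ) : 0 ≤ fullDensity α := by
  unfold fullDensity; split_ifs
  · exact abs_nonneg _
  · linarith [seven_tenths_le_quarterLevel]

/-- The full density is at most `1`. -/
theorem fullDensity_le_one (α : ℝ) : fullDensity α ≤ 1 := by
  unfold fullDensity; split_ifs with h
  · exact h
  · exact quarterLevel_le_one

/-- `nearestFour` is measurable. -/
theorem measurable_nearestFour : Measurable nearestFour := by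
  unfold nearestFour
  refine Measurable.const_mul ?_ 4
  exact (measurable_from_top (f := (Int.cast : ℤ → ℝ))).comp (Int.measurable_floor.comp (by fun_prop))

/-- `quarterDensity` is measurable. -/
theorem measurable_quarterDensity : Measurable quarterDensity := by
  have h1 : Measurable fun α : ℝ => |α - nearestFour α| :=
    continuous_abs.measurable.comp (measurable_id.sub measurable_nearestFour)
  unfold quarterDensity
  refine Measurable.ite (measurableSet_le continuous_abs.measurable measurable_const)
    measurable_const ?_
  exact Measurable.ite (measurableSet_le h1 measurable_const) h1 measurable_const

/-- `fullDensity` is measurable. -/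
theorem measurable_fullDensity : Measurable fullDensity := by
  have h1 : Measurable fun α : ℝ => |α - nearestFour α| :=
    continuous_abs.measurable.comp (measurable_id.sub measurable_nearestFour)
  unfold fullDensity
  exact Measurable.ite (measurableSet_le h1 measurable_const) h1 measurable_const

/-! #### The lattice sum in real form -/

/-- Quadratic decay ⇒ the samples `r(n/4)` are summable over `ℤ`. -/
theorem summable_sample_quarter {r : ℝ → ℝ} (hdecay : ∃ C : ℝ, ∀ u : ℝ, |r u| ≤ C / (1 + u ^ 2)) :
    Summable fun n : ℤ => |r ((n : ℝ) / 4)| := by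
  obtain ⟨C, hC⟩ := hdecay
  have hC0 : 0 ≤ C := by
    have := hC 0
    simp only [ne_eq, OfNat.ofNat_ne_zero, not_false_eq_true, zero_pow, add_zero, div_one] at this
    exact le_trans (abs_nonneg _) this
  refine Summable.of_nonneg_of_le (fun n => abs_nonneg _) (fun n => ?_)
    (summable_const_div_one_add_sq_int (16 * C))
  refine le_trans (hC _) ?_
  rw [div_le_div_iff₀ (by positivity) (by positivity)]
  nlinarith [sq_nonneg (n : ℝ)]

/-- A `ℤ`-indexed series with odd terms sums to zero. -/
theorem tsum_eq_zero_of_odd {b : ℤ → ℂ} (hodd : ∀ n : ℤ, b (-n) = -b n) : ∑' n : ℤ, b n = 0 := by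
  have h1 : ∑' n : ℤ, b (-n) = ∑' n : ℤ, b n := (Equiv.neg ℤ).tsum_eq b
  have h2 : ∑' n : ℤ, b (-n) = -∑' n : ℤ, b n := by
    simp_rw [hodd]; exact tsum_neg
  have h3 : ∑' n : ℤ, b n + ∑' n : ℤ, b n = 0 := eq_neg_iff_add_eq_zero.mp (h1.symm.trans h2)
  have h4 : (2 : ℂ) * ∑' n : ℤ, b n = 0 := by rw [two_mul]; exact h3
  exact (mul_eq_zero.mp h4).resolve_left two_ne_zero

/-- `e^{2πinx} = cos(πnβ/2) + i sin(πnβ/2)` at `x = β/4`. -/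
theorem fourier_quarter (n : ℤ) (β : ℝ) :
    fourier n (((β / 4 : ℝ)) : UnitAddCircle) =
      (Real.cos (π * n * β / 2) : ℂ) + (Real.sin (π * n * β / 2) : ℂ) * I := by
  rw [fourier_coe_apply, Complex.ofReal_cos, Complex.ofReal_sin, ← Complex.exp_mul_I]
  congr 1
  push_cast
  ring

/-- **Poisson summation on `¼ℤ`, real form** (PROVED):
`Σ_{j∈ℤ} r̂(β + 4j) = ¼ Σ_{n∈ℤ} r(n/4) cos(πnβ/2)`. -/
theorem quarter_poisson_real {r : ℝ → ℝ} (heven : ∀ u : ℝ, r (-u) = r u) (hcont : Continuous r)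
    (hint : Integrable r) (hdecay : ∃ C : ℝ, ∀ u : ℝ, |r u| ≤ C / (1 + u ^ 2))
    (htdecay : ∃ C : ℝ, ∀ α : ℝ, |BGMM2023.cosTransform r α| ≤ C / (1 + α ^ 2)) (β : ℝ) :
    ∑' j : ℤ, BGMM2023.cosTransform r (β + 4 * j) =
      ∑' n : ℤ, 1 / 4 * r ((n : ℝ) / 4) * Real.cos (π * n * β / 2) := by
  have key := quarter_poisson heven hcont hint hdecay htdecay (β / 4)
  have e1 : ∀ j : ℤ, 4 * (β / 4 + (j : ℝ)) = β + 4 * j := by intro j; ring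
  simp_rw [e1, fourier_quarter] at key
  -- split the right-hand side into cosine and sine series
  have hs := summable_sample_quarter hdecay
  have hcosS : Summable fun n : ℤ =>
      ((1 / 4 * r ((n : ℝ) / 4) * Real.cos (π * n * β / 2) : ℝ) : ℂ) := by
    refine Summable.of_norm_bounded (hs.mul_left (1 / 4)) fun n => ?_
    rw [Complex.norm_real, Real.norm_eq_abs, abs_mul, abs_mul, abs_of_pos (by norm_num : (0:ℝ) < 1/4)]
    exact mul_le_of_le_one_right (by positivity) (Real.abs_cos_le_one _)
  have hsinS : Summable fun n : ℤ =>
      ((1 / 4 * r ((n : ℝ) / 4) * Real.sin (π * n * β / 2) : ℝ) : ℂ) := by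
    refine Summable.of_norm_bounded (hs.mul_left (1 / 4)) fun n => ?_
    rw [Complex.norm_real, Real.norm_eq_abs, abs_mul, abs_mul, abs_of_pos (by norm_num : (0:ℝ) < 1/4)]
    exact mul_le_of_le_one_right (by positivity) (Real.abs_sin_le_one _)
  have hsplit : ∀ n : ℤ, (1 / 4 : ℂ) * (r ((n : ℝ) / 4) : ℂ) *
      ((Real.cos (π * n * β / 2) : ℂ) + (Real.sin (π * n * β / 2) : ℂ) * I)
      = ((1 / 4 * r ((n : ℝ) / 4) * Real.cos (π * n * β / 2) : ℝ) : ℂ)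
        + ((1 / 4 * r ((n : ℝ) / 4) * Real.sin (π * n * β / 2) : ℝ) : ℂ) * I := by
    intro n; push_cast; ring
  simp_rw [hsplit] at key
  have hodd : ∑' n : ℤ, ((1 / 4 * r ((n : ℝ) / 4) * Real.sin (π * n * β / 2) : ℝ) : ℂ) = 0 := by
    refine tsum_eq_zero_of_odd fun n => ?_
    have hr : r (((-n : ℤ) : ℝ) / 4) = r ((n : ℝ) / 4) := by
      rw [Int.cast_neg, show -(n : ℝ) / 4 = -((n : ℝ) / 4) by ring, heven]
    have hsin : Real.sin (π * ((-n : ℤ) : ℝ) * β / 2) = -Real.sin (π * n * β / 2) := by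
      rw [Int.cast_neg, show π * -(n : ℝ) * β / 2 = -(π * n * β / 2) by ring, Real.sin_neg]
    rw [hr, hsin]; push_cast; ring
  rw [hcosS.tsum_add (hsinS.mul_right I), tsum_mul_right, hodd, zero_mul, add_zero,
    ← Complex.ofReal_tsum, ← Complex.ofReal_tsum] at key
  exact_mod_cast key

/-! #### The density part: decomposition of `ℝ` into the cells `(4j−2, 4j+2]` -/

/-- Continuous with quadratic decay ⇒ integrable. -/
theorem integrable_of_quadratic_decay {R : ℝ → ℝ} (hR : Continuous R)
    (hdecay : ∃ C : ℝ, ∀ α : ℝ, |R α| ≤ C / (1 + α ^ 2)) : Integrable R := by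
  obtain ⟨C, hC⟩ := hdecay
  refine Integrable.mono' ((integrable_inv_one_add_sq).const_mul C) hR.aestronglyMeasurable ?_
  filter_upwards with α
  rw [Real.norm_eq_abs]
  simpa [div_eq_mul_inv] using hC α

/-- Cell arithmetic: `(4j)² ≤ 4(1 + (x+4j)²)`-type bound on `[−2,2]`. -/
theorem sq_le_sq_cell {x : ℝ} (j : ℤ) (hx1 : -2 ≤ x) (hx2 : x ≤ 2) :
    (j : ℝ) ^ 2 ≤ (x + 4 * j) ^ 2 := by
  rcases lt_trichotomy j 0 with hj | hj | hj
  · have hj' : (j : ℝ) ≤ -1 := by exact_mod_cast (show j ≤ -1 by omega)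
    have h1 : x + 3 * j ≤ 0 := by linarith
    have h2 : x + 5 * j ≤ 0 := by linarith
    nlinarith [mul_nonneg (neg_nonneg.mpr h1) (neg_nonneg.mpr h2)]
  · subst hj; norm_num; positivity
  · have hj' : (1 : ℝ) ≤ j := by exact_mod_cast (show 1 ≤ j by omega)
    have h1 : 0 ≤ x + 3 * j := by linarith
    have h2 : 0 ≤ x + 5 * j := by linarith
    nlinarith [mul_nonneg h1 h2]

/-- `∫_ℝ f = Σ_{j∈ℤ} ∫_{−2}^{2} f(x + 4j) dx` for integrable `f`. -/
theorem integral_eq_tsum_cells {f : ℝ → ℝ} (hf : Integrable f) :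
    ∫ x, f x = ∑' j : ℤ, ∫ x in (-2 : ℝ)..2, f (x + 4 * j) := by
  have hs : ∀ j : ℤ, MeasurableSet (Set.Ioc (-2 + 4 * (j : ℝ)) (2 + 4 * j)) :=
    fun j => measurableSet_Ioc
  have hd : Pairwise (Function.onFun Disjoint fun j : ℤ => Set.Ioc (-2 + 4 * (j : ℝ)) (2 + 4 * j)) := by
    intro i j hij
    rcases lt_or_gt_of_ne hij with h | h
    · have h' : (i : ℝ) + 1 ≤ j := by exact_mod_cast (show i + 1 ≤ j by omega)
      exact Set.disjoint_left.mpr fun x hx hx' => by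
        have := hx.2; have := hx'.1; linarith
    · have h' : (j : ℝ) + 1 ≤ i := by exact_mod_cast (show j + 1 ≤ i by omega)
      exact Set.disjoint_left.mpr fun x hx hx' => by
        have := hx.1; have := hx'.2; linarith
  have hU : (⋃ j : ℤ, Set.Ioc (-2 + 4 * (j : ℝ)) (2 + 4 * j)) = Set.univ := by
    refine Set.eq_univ_of_forall fun x => Set.mem_iUnion.mpr ⟨⌈(x - 2) / 4⌉, ?_, ?_⟩
    · have := Int.ceil_lt_add_one ((x - 2) / 4)
      linarith
    · have := Int.le_ceil ((x - 2) / 4)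
      linarith
  have h1 := MeasureTheory.integral_iUnion hs hd hf.integrableOn
  rw [hU, MeasureTheory.setIntegral_univ] at h1
  rw [h1]
  refine tsum_congr fun j => ?_
  rw [intervalIntegral.integral_comp_add_right f (4 * (j : ℝ)),
    intervalIntegral.integral_of_le (by linarith)]

/-- Uniform bound for `r̂(x + 4j)` on the cell. -/
theorem cell_shift_bound {R : ℝ → ℝ} {C' : ℝ} (hC : ∀ α : ℝ, |R α| ≤ C' / (1 + α ^ 2))
    {x : ℝ} (hx1 : -2 ≤ x) (hx2 : x ≤ 2) (j : ℤ) :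
    |R (x + 4 * j)| ≤ C' / (1 + (j : ℝ) ^ 2) := by
  have hC0 : 0 ≤ C' := by
    have := hC 0
    simp only [ne_eq, OfNat.ofNat_ne_zero, not_false_eq_true, zero_pow, add_zero, div_one] at this
    exact le_trans (abs_nonneg _) this
  refine le_trans (hC _) ?_
  exact div_le_div_of_nonneg_left hC0 (by positivity) (by linarith [sq_le_sq_cell j hx1 hx2])

/-- **The density part** (PROVED): `∫_ℝ G·r̂ = Σ_{n∈ℤ} ¼ r(n/4) · ∫_{−2}^{2} cos(πnx/2) G(x) dx`
— cell decomposition, Poisson summation on each fibre, and two dominated interchanges. -/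
theorem integral_fullDensity_mul {r : ℝ → ℝ} (heven : ∀ u : ℝ, r (-u) = r u) (hcont : Continuous r)
    (hint : Integrable r) (hdecay : ∃ C : ℝ, ∀ u : ℝ, |r u| ≤ C / (1 + u ^ 2))
    (htdecay : ∃ C : ℝ, ∀ α : ℝ, |BGMM2023.cosTransform r α| ≤ C / (1 + α ^ 2)) :
    ∫ α, fullDensity α * BGMM2023.cosTransform r α =
      ∑' n : ℤ, 1 / 4 * r ((n : ℝ) / 4) *
        ∫ x in (-2 : ℝ)..2, Real.cos (π * n * x / 2) * fullDensity x := by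
  set R := BGMM2023.cosTransform r with hRdef
  have hRc : Continuous R := continuous_cosTransform hint
  have hRi : Integrable R := integrable_of_quadratic_decay hRc htdecay
  -- integrability of `G·R`
  have hGR : Integrable fun α => fullDensity α * R α := by
    refine Integrable.mono' hRi.norm
      (measurable_fullDensity.mul hRc.measurable).aestronglyMeasurable (ae_of_all _ fun α => ?_)
    rw [norm_mul, Real.norm_eq_abs, abs_of_nonneg (fullDensity_nonneg α)]
    exact mul_le_of_le_one_left (norm_nonneg _) (fullDensity_le_one α)
  -- step 1: cells
  rw [integral_eq_tsum_cells hGR]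
  simp_rw [fullDensity_add_four_mul]
  have hI : ∀ j : ℤ, ∫ x in (-2 : ℝ)..2, fullDensity x * R (x + 4 * j)
      = ∫ x in Set.Ioc (-2 : ℝ) 2, fullDensity x * R (x + 4 * j) :=
    fun j => intervalIntegral.integral_of_le (by norm_num)
  simp_rw [hI]
  -- step 2: first interchange
  have hmeas : ∀ j : ℤ, AEStronglyMeasurable (fun x => fullDensity x * R (x + 4 * j))
      (volume.restrict (Set.Ioc (-2 : ℝ) 2)) := fun j =>
    (measurable_fullDensity.mul (hRc.measurable.comp (measurable_id.add_const _))).aestronglyMeasurable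
  obtain ⟨C', hC'⟩ := htdecay
  have hC0 : 0 ≤ C' := by
    have := hC' 0
    simp only [ne_eq, OfNat.ofNat_ne_zero, not_false_eq_true, zero_pow, add_zero, div_one] at this
    exact le_trans (abs_nonneg _) this
  have hfin : ∑' j : ℤ, ∫⁻ x in Set.Ioc (-2 : ℝ) 2, ‖fullDensity x * R (x + 4 * j)‖ₑ ≠ ⊤ := by
    have hb : ∀ j : ℤ, ∫⁻ x in Set.Ioc (-2 : ℝ) 2, ‖fullDensity x * R (x + 4 * j)‖ₑ
        ≤ ENNReal.ofReal (4 * (C' / (1 + (j : ℝ) ^ 2))) := by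
      intro j
      have hcj : 0 ≤ C' / (1 + (j : ℝ) ^ 2) := div_nonneg hC0 (by positivity)
      calc ∫⁻ x in Set.Ioc (-2 : ℝ) 2, ‖fullDensity x * R (x + 4 * j)‖ₑ
          ≤ ∫⁻ x in Set.Ioc (-2 : ℝ) 2, ENNReal.ofReal (C' / (1 + (j : ℝ) ^ 2)) := by
            refine setLIntegral_mono' measurableSet_Ioc fun x hx => ?_
            rw [Real.enorm_eq_ofReal_abs]
            refine ENNReal.ofReal_le_ofReal ?_
            rw [abs_mul, abs_of_nonneg (fullDensity_nonneg x)]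
            calc fullDensity x * |R (x + 4 * j)| ≤ 1 * (C' / (1 + (j : ℝ) ^ 2)) :=
                  mul_le_mul (fullDensity_le_one x) (cell_shift_bound hC' hx.1.le hx.2 j)
                    (abs_nonneg _) zero_le_one
              _ = C' / (1 + (j : ℝ) ^ 2) := one_mul _
        _ = ENNReal.ofReal (C' / (1 + (j : ℝ) ^ 2)) * volume (Set.Ioc (-2 : ℝ) 2) :=
            setLIntegral_const _ _
        _ = ENNReal.ofReal (4 * (C' / (1 + (j : ℝ) ^ 2))) := by
            rw [Real.volume_Ioc, show (2 : ℝ) - -2 = 4 by norm_num, ← ENNReal.ofReal_mul hcj, mul_comm]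
    have key : ∑' j : ℤ, ∫⁻ x in Set.Ioc (-2 : ℝ) 2, ‖fullDensity x * R (x + 4 * j)‖ₑ
        ≤ ENNReal.ofReal (∑' j : ℤ, 4 * (C' / (1 + (j : ℝ) ^ 2))) :=
      calc ∑' j : ℤ, ∫⁻ x in Set.Ioc (-2 : ℝ) 2, ‖fullDensity x * R (x + 4 * j)‖ₑ
          ≤ ∑' j : ℤ, ENNReal.ofReal (4 * (C' / (1 + (j : ℝ) ^ 2))) := ENNReal.tsum_le_tsum hb
        _ = ENNReal.ofReal (∑' j : ℤ, 4 * (C' / (1 + (j : ℝ) ^ 2))) :=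
            (ENNReal.ofReal_tsum_of_nonneg (fun j => mul_nonneg (by norm_num)
              (div_nonneg hC0 (by positivity))) ((summable_const_div_one_add_sq_int C').mul_left 4)).symm
    exact ne_top_of_le_ne_top ENNReal.ofReal_ne_top key
  rw [← MeasureTheory.integral_tsum hmeas hfin]
  simp_rw [tsum_mul_left]
  have hP : ∀ x : ℝ, ∑' j : ℤ, R (x + 4 * j) = ∑' n : ℤ, 1 / 4 * r ((n : ℝ) / 4) * Real.cos (π * n * x / 2) :=
    fun x => quarter_poisson_real heven hcont hint hdecay ⟨C', hC'⟩ x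
  simp_rw [hP, ← tsum_mul_left]
  -- step 3: second interchange
  have hs := summable_sample_quarter hdecay
  have hmeas2 : ∀ n : ℤ, AEStronglyMeasurable
      (fun x => fullDensity x * (1 / 4 * r ((n : ℝ) / 4) * Real.cos (π * n * x / 2)))
      (volume.restrict (Set.Ioc (-2 : ℝ) 2)) := fun n =>
    (measurable_fullDensity.mul (by fun_prop)).aestronglyMeasurable
  have hfin2 : ∑' n : ℤ, ∫⁻ x in Set.Ioc (-2 : ℝ) 2,
      ‖fullDensity x * (1 / 4 * r ((n : ℝ) / 4) * Real.cos (π * n * x / 2))‖ₑ ≠ ⊤ := by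
    have hb : ∀ n : ℤ, ∫⁻ x in Set.Ioc (-2 : ℝ) 2,
        ‖fullDensity x * (1 / 4 * r ((n : ℝ) / 4) * Real.cos (π * n * x / 2))‖ₑ
        ≤ ENNReal.ofReal (|r ((n : ℝ) / 4)|) := by
      intro n
      calc ∫⁻ x in Set.Ioc (-2 : ℝ) 2,
            ‖fullDensity x * (1 / 4 * r ((n : ℝ) / 4) * Real.cos (π * n * x / 2))‖ₑ
          ≤ ∫⁻ x in Set.Ioc (-2 : ℝ) 2, ENNReal.ofReal (1 / 4 * |r ((n : ℝ) / 4)|) := by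
            refine setLIntegral_mono' measurableSet_Ioc fun x hx => ?_
            rw [Real.enorm_eq_ofReal_abs]
            refine ENNReal.ofReal_le_ofReal ?_
            rw [abs_mul, abs_mul, abs_mul, abs_of_nonneg (fullDensity_nonneg x),
              abs_of_pos (by norm_num : (0:ℝ) < 1 / 4)]
            have h1 := fullDensity_le_one x
            have h2 := fullDensity_nonneg x
            have h3 := Real.abs_cos_le_one (π * n * x / 2)
            have h4 := abs_nonneg (Real.cos (π * n * x / 2))
            have h5 := abs_nonneg (r ((n : ℝ) / 4))
            nlinarith [mul_le_mul h1 h3 h4 zero_le_one, mul_nonneg h2 h4]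
        _ = ENNReal.ofReal (1 / 4 * |r ((n : ℝ) / 4)|) * volume (Set.Ioc (-2 : ℝ) 2) :=
            setLIntegral_const _ _
        _ = ENNReal.ofReal (|r ((n : ℝ) / 4)|) := by
            rw [Real.volume_Ioc, show (2 : ℝ) - -2 = 4 by norm_num,
              ← ENNReal.ofReal_mul (by positivity)]
            congr 1; ring
    have key : ∑' n : ℤ, ∫⁻ x in Set.Ioc (-2 : ℝ) 2,
          ‖fullDensity x * (1 / 4 * r ((n : ℝ) / 4) * Real.cos (π * n * x / 2))‖ₑ
        ≤ ENNReal.ofReal (∑' n : ℤ, |r ((n : ℝ) / 4)|) :=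
      calc ∑' n : ℤ, ∫⁻ x in Set.Ioc (-2 : ℝ) 2,
            ‖fullDensity x * (1 / 4 * r ((n : ℝ) / 4) * Real.cos (π * n * x / 2))‖ₑ
          ≤ ∑' n : ℤ, ENNReal.ofReal (|r ((n : ℝ) / 4)|) := ENNReal.tsum_le_tsum hb
        _ = ENNReal.ofReal (∑' n : ℤ, |r ((n : ℝ) / 4)|) :=
            (ENNReal.ofReal_tsum_of_nonneg (fun n => abs_nonneg _) hs).symm
    exact ne_top_of_le_ne_top ENNReal.ofReal_ne_top key
  rw [MeasureTheory.integral_tsum hmeas2 hfin2]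
  refine tsum_congr fun n => ?_
  rw [intervalIntegral.integral_of_le (by norm_num), ← integral_const_mul]
  congr 1
  ext x
  ring


end Bookkeeping

end Summit.Parity.GeneralizedHardyLittlewood.Theorems.PrimeLevelFamEdgeIdeaDeltas.FloorDual
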